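import Summits.Ventures.HodgeRepro2.T5GaloisTransport
import Summits.Ventures.HodgeRepro2.T5CoprimeCompositum

/-!
# T5SplittingOrbit — «D = ∅ or D = all» for the primes of a tower `A ⊆ B ⊆ C` under a group
acting compatibly on `B` and `C`

Kernel witness (cell pub-hodge-repro2, seat p3, Tier-5 support for sub-step N2) assembling
T5GaloisTransport (p393971) and T5CoprimeCompositum (p393430) into the clause of
route/T5-N2-route-3.md §N2.8.2(c): «“w non-split in E” is constant on the Gal(F⁺/ℚ)-orbit of
dyadic places since every σ ∈ Gal(F⁺/ℚ) extends to E (E/ℚ Galois) ✓ — so D = ∅ or D = all».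

Reading: `A = ℤ`, `B = 𝓞_{F⁺}`, `C = 𝓞_E`, `G = Gal(E/ℚ)` acting on `𝓞_E` and, through its
restriction to `F⁺`, on `𝓞_{F⁺}` (Mathlib `galRestrict`; the compatibility `hcomp` says that the
inclusion `𝓞_{F⁺} ⊆ 𝓞_E` is `G`-equivariant); `p = (2)`; `D` = the dyadic primes `𝔭` of `F⁺`
with exactly `n = 1` prime of `E` above (= «non-split»). Mathlib supplies the transitivity of `G`
on `primesOver p B` in the Galois case (`Ideal.isPretransitive_of_isGaloisGroup`).

What is kernel-checked here:

* `symm_comm_of_action`: the automorphism of `C` given by `g⁻¹` lies over the one of `B` given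
  by `g⁻¹` (from `hcomp`);
* `ncard_primesOver_smul`: the number of primes of `C` over `g • 𝔭` equals the number over `𝔭`
  (`T5GaloisTransport.ncard_primesOver_comap` with `g • 𝔭 = 𝔭.comap (g⁻¹)`);
* `smul_mem_countSet`, `countSet_eq_empty_or_univ`: for every `n`, the set of primes of `B` over
  `p` with exactly `n` primes of `C` above them is `G`-stable, hence — when `G` acts transitively
  on `primesOver p B` — empty or everything: «D = ∅ or D = all».

What stays prose (labels unchanged): the instantiation of `G`, the two actions and `hcomp` for
the rings of integers of `E / F⁺ / ℚ` (Mathlib `galRestrict` + the lifting of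
`T5CoprimeCompositum.exists_extension_of_normal`), and that «non-split» means `n = 1`.

README §8(d): this file uses an L-value-free non-vanishing device: NO.
-/

namespace Summit.Ventures.HodgeRepro2.T5SplittingOrbit

open Ideal
open scoped Pointwise

variable {A B C G : Type*} [CommRing A] [CommRing B] [CommRing C] [Algebra A B] [Algebra B C]
  [Group G] [MulSemiringAction G B] [MulSemiringAction G C]
  (hcomp : ∀ (g : G) (b : B), algebraMap B C (g • b) = g • algebraMap B C b)

include hcomp

/-- The automorphism of `C` given by `g⁻¹` lies over the automorphism of `B` given by `g⁻¹`. -/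
theorem symm_comm_of_action (g : G) (b : B) :
    (MulSemiringAction.toRingAut G C g).symm (algebraMap B C b) =
      algebraMap B C ((MulSemiringAction.toRingAut G B g).symm b) := by
  simp only [MulSemiringAction.toRingAut_apply, MulSemiringAction.toRingEquiv_apply_symm_apply,
    hcomp]

/-- The number of primes of `C` over `g • 𝔭` equals the number over `𝔭`. -/
theorem ncard_primesOver_smul (g : G) (𝔭 : Ideal B) :
    (primesOver (g • 𝔭) C).ncard = (primesOver 𝔭 C).ncard := by
  rw [Ideal.pointwise_smul_eq_comap]
  exact (T5GaloisTransport.ncard_primesOver_comap (MulSemiringAction.toRingAut G B g).symm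
    (MulSemiringAction.toRingAut G C g).symm (symm_comm_of_action hcomp g) 𝔭).symm

variable (p : Ideal A) [SMulCommClass G A B]

/-- The set of primes of `B` over `p` with exactly `n` primes of `C` above them is `G`-stable. -/
theorem smul_mem_countSet (n : ℕ) (g : G) (Q : primesOver p B)
    (hQ : (primesOver Q.1 C).ncard = n) : (primesOver (g • Q).1 C).ncard = n := by
  rw [Ideal.coe_smul_primesOver, ncard_primesOver_smul hcomp g, hQ]

/-- «D = ∅ or D = all»: if `G` acts transitively on the primes of `B` over `p`, then for every
`n` the set of those primes with exactly `n` primes of `C` above them is empty or everything. -/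
theorem countSet_eq_empty_or_univ [MulAction.IsPretransitive G (primesOver p B)] (n : ℕ) :
    {Q : primesOver p B | (primesOver Q.1 C).ncard = n} = ∅ ∨
      {Q : primesOver p B | (primesOver Q.1 C).ncard = n} = Set.univ :=
  T5CoprimeCompositum.eq_empty_or_univ_of_smul_stable _
    (fun g Q hQ => smul_mem_countSet hcomp p n g Q hQ)

end Summit.Ventures.HodgeRepro2.T5SplittingOrbit
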